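import Summits.HodgeConjecture.HodgeConjecture.Theorems.F0P3SpectralPacketSphericalRigidity   -- ★ LH7-p03 p848041: `xiRigidityGHom_of_marker_laws_of_meet`, `GlobalPacket.sph_eq_comap_symm_of_evpAtψ_eq` (+ ★ p847962, ★ 3v∕3w∕3a∕2∕1)
import HarnessLib

/-!
# (PK-A-G) RIGIDITY — ORGAN 3 OF LINE LH7, KIT-GENERIC CLOSER: (L1″) `XiRigidityGHom` FROM THE MARKER LAWS, SATAKE (in-house) AND THE KIT-FREE RIGID CORE (Thm. 13.3.6 (c), finite part)
# (Rogawski §13.3 Thm. 13.3.5, Thm. 13.3.6 (c) p. 202, p. 199 ¶2; §13.7 p. 206; Cartier, Corvallis §IV.1 Cor. 4.1)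

Cell `hodgecm-mathlib`, F0∕P3c line LH7 (closer stub `stub_PKtuple : PKtupleLetter`, `Cruxes/H413/Lines/F0_U3LettersRung1.lean` ED. 38 «PK-ε», row #181),
crux H413 = `stmt-HodgeConjecture-24833`; organ payer LH7-p03 (g0), DEALT BY NAME (LH7-plan (g0) DEALS 2∕2 02:36:25Z): **O3 `stub_PKrigidGOfCore : PKrigidGOfCoreLetter`** of the
pay-down skeleton `F0/P3c/LH7/LH7-plan/g0/StubPKtuple.paydown.skeleton.v1.lean` 5c95c6a1b7db0afd :287–:394.  THIS FILE is the kit-generic closer the organ's tie instantiates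
at the letter's record (`Pk′ := xiPacketFamilyOfRecordSCD …`, `ψ := 𝔨.ψ`, `ν′ := νG`, `tXi := xiEvpOfRecordSCD … νG`, the rows of `hlaws : TupleKitLaws …`, the guard `hS₀`, binder 33
`hvol`, the RIGID-CORE hypothesis verbatim).  `--supports stmt-HodgeConjecture-24833`; closes no stub by itself; touches neither `𝔩.pair` nor the `ε` slot (LEAD T12-11 (5)).

THE MATHEMATICS.  ★ p848041 `xiRigidityGHom_of_marker_laws_of_meet` leaves ONE input `hA`: «every coherent ALL-A packet `Q` with the ξ-germ off `S ⊇ ramG Q` MEETS `Π(ξ_v)` at EVERY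
place».  Here `hA` is DERIVED from the KIT-FREE core of Thm. 13.3.6 (c) in the organ's own shape —
  `hcore : ∀ ξ π, π occurs in L²_d(G, μ) → (π_v = πⁿ(ξ_v) ∘ ψ_v⁻¹ for almost all v) → ∀ v, π_v = πⁿ(ξ_v) ∘ ψ_v⁻¹ ∨ πˢ(ξ_v) ∘ ψ_v⁻¹ = π_v` —
as follows [§13.3 p. 203 ¶2; Thm. 13.3.6 (c); §13.7 p. 206]: a discrete packet `Q` has a member family `π` occurring discretely (★ 3a `exists_mem_occurs`), with `π_v = π_v⁰ = sph Q_v`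
for almost all `v` (★ FILE 2 `Mem`); at every `v ∉ S ∪ S₀ ∪ ram ξ` the e.v.p. pins `sph Q_v = πⁿ(ξ_v) ∘ ψ_v⁻¹` (Satake injectivity, ★ p848041 `sph_eq_comap_symm_of_evpAtψ_eq`); so
`π_v = πⁿ(ξ_v) ∘ ψ_v⁻¹` for almost all `v`, the core gives `π_v ∈ Π(ξ_v)` at EVERY `v`, and since `π_v ∈ Q_v` (membership) the token `Q_v` meets `Π(ξ_v)` everywhere — for ANY `Q`
with the ξ-germ, all-A or not (the all-L case was already absurd by ★ p848041∕(KM2)).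

CONTENTS (namespace ★ 3a∕3w `…F0P3SpectralPacket.SpectralPacketG`):
* `eventually_mem_eq_transport_πn_of_eqOff` — a member family of a packet with the ξ-germ is `πⁿ(ξ_v) ∘ ψ_v⁻¹` cofinitely;
* `meets_of_core_of_eqOff` — with the core: such a packet's tokens meet `Π(ξ_v)` at every place;
* **`xiRigidityGHom_of_marker_laws_of_core`** — (L1″) from (KM1)∕(KJ-G)∕(KM2)∕(KM3) + (KG1) + (KG3′) + guard + `vol(K′_v) ≠ 0` + record shapes `hsph`∕`hadmn`∕`ht` + `hcore`.
No instance, no notation, no named fact, no `sorry`.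
HONEST LABEL: HC_CM is proved only modulo the 7 printed citations (2 remaining: hLiu418 = stmt-HodgeConjecture-24832, h413 = stmt-HodgeConjecture-24833) until rung 0 closes;
this file proves no printed statement — given the kit laws it reduces the rigidity conjunct of (PK-A-G) to the kit-free finite part of Thm. 13.3.6 (c) (organ O2, print).

References: [Rogawski1990] §13.3 Thm. 13.3.5 p. 202, Thm. 13.3.6 (c) p. 202, p. 203 ¶2, p. 199 ¶2, p. 201 ll. 16–18; §13.2 p. 200 l. 1–3; §13.7 p. 206; §12.2 p. 174 l. 1.
[CartierCorvallis1979] §IV.1 Cor. 4.1.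
-/

set_option autoImplicit false
-- the mandated namespace repeats `HodgeConjecture.HodgeConjecture`, as in every `Theorems/*.lean` of this sub-problem
set_option linter.dupNamespace false

noncomputable section

open NumberField IsDedekindDomain MeasureTheory Filter
open scoped Matrix MatrixGroups

open Literature.NumberTheory Literature.NumberTheory.Automorphic Literature.NumberTheory.Automorphic.UnitaryGroup
open Literature.NumberTheory.Rogawski1990 Literature.NumberTheory.GaloisRepresentations
open Literature.RepresentationTheory.BorelWallach2000 Literature.RepresentationTheory.KonnoKonno2007
open Summit.HodgeConjecture.HodgeConjecture.Cruxes.H413.F0P3InnerFormClassificationV6 (splitForm EvpData EqOff)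
open Summit.HodgeConjecture.HodgeConjecture.Cruxes.H413.F0P3LocalPacketKit
open Summit.HodgeConjecture.HodgeConjecture.Cruxes.H413.F0P3ArchPacketKit

namespace Summit.HodgeConjecture.HodgeConjecture.Cruxes.H413.F0P3SpectralPacket.SpectralPacketG

open Summit.HodgeConjecture.HodgeConjecture.Cruxes.H413.F0P3GlobalPacket

variable {L : Type} [Field L] [NumberField L] [IsCMField L] {H : Matrix (Fin 3) (Fin 3) L}
  {𝔩 : ∀ v : HeightOneSpectrum (𝓞 ↥(maximalRealSubfield L)), LocalPacketKit L (splitForm L 3) v} {𝔞 : ArchPacketKit}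
  {μ : Measure (adelicGroupData (↥(maximalRealSubfield L)) L (IsCMField.complexConj L) 3 (splitForm L 3)).automorphicQuotient}
  [SMulInvariantMeasure (adelicGroupData (↥(maximalRealSubfield L)) L (IsCMField.complexConj L) 3 (splitForm L 3)).Adelic
    (adelicGroupData (↥(maximalRealSubfield L)) L (IsCMField.complexConj L) 3 (splitForm L 3)).automorphicQuotient μ]
  [∀ v : HeightOneSpectrum (𝓞 ↥(maximalRealSubfield L)), MeasurableSpace ((cmDatum L 3 (splitForm L 3)).Local v)]
  [∀ v : HeightOneSpectrum (𝓞 ↥(maximalRealSubfield L)), BorelSpace ((cmDatum L 3 (splitForm L 3)).Local v)]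
  [∀ v : HeightOneSpectrum (𝓞 ↥(maximalRealSubfield L)), MeasurableSpace ((cmDatum L 3 H).Local v)]
  [∀ v : HeightOneSpectrum (𝓞 ↥(maximalRealSubfield L)), BorelSpace ((cmDatum L 3 H).Local v)]
  {νG' : ∀ v : HeightOneSpectrum (𝓞 ↥(maximalRealSubfield L)), Measure ((cmDatum L 3 H).Local v)}
  [∀ v, (νG' v).IsMulLeftInvariant] [∀ v, IsFiniteMeasureOnCompacts (νG' v)]
  {ψ : ∀ v : HeightOneSpectrum (𝓞 ↥(maximalRealSubfield L)), (cmDatum L 3 H).Local v ≃ₜ* (cmDatum L 3 (splitForm L 3)).Local v}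
  {Pk' : OneDimAutRepH L → ∀ v : HeightOneSpectrum (𝓞 ↥(maximalRealSubfield L)), CMLocalAPacket L H v}
  {ram : OneDimAutRepH L → Finset (HeightOneSpectrum (𝓞 ↥(maximalRealSubfield L)))}

/-- **A MEMBER FAMILY OF A PACKET WITH THE ξ-GERM IS `πⁿ(ξ_v) ∘ ψ_v⁻¹` COFINITELY**: if `π ∈ Q` (★ FILE 2 `Mem`: `π_v ∈ Q_v` everywhere, `π_v = sph Q_v` for almost all `v`) and `t(Q) = t(ξ)`
off a finite `S`, then — Satake injectivity at every `v ∉ S ∪ S₀ ∪ ram ξ` (★ `sph_eq_comap_symm_of_evpAtψ_eq`) — `π_v = (transportAPackets ψ Pk′ ξ v).πn` for almost all `v`.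
[cite: Rogawski1990, §13.3 p. 203 ¶2; §13.7 p. 206] [cite: CartierCorvallis1979, §IV.1 Cor. 4.1] -/
theorem eventually_mem_eq_transport_πn_of_eqOff (h4 : ∀ v : HeightOneSpectrum (𝓞 ↥(maximalRealSubfield L)), (𝔩 v).UnramLaw)
    (hKG3 : ∀ (v : HeightOneSpectrum (𝓞 ↥(maximalRealSubfield L))) (P : (𝔩 v).Pkt), ∀ π ∈ (𝔩 v).mem P, π.IsAdmissible)
    (S₀ : Finset (HeightOneSpectrum (𝓞 ↥(maximalRealSubfield L))))
    (hψK : ∀ v ∉ S₀, (cmLocalIntegralLevel L 3 H v).map (ψ v : (cmDatum L 3 H).Local v →* (cmDatum L 3 (splitForm L 3)).Local v) =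
      cmLocalIntegralLevel L 3 (splitForm L 3) v)
    (hvol : ∀ v : HeightOneSpectrum (𝓞 ↥(maximalRealSubfield L)), (νG' v).real (cmLocalIntegralLevel L 3 H v : Set ((cmDatum L 3 H).Local v)) ≠ 0)
    (hsph : ∀ (ξ : OneDimAutRepH L), ∀ v ∉ ram ξ, (Pk' ξ v).πn.IsSpherical (cmLocalIntegralLevel L 3 H v))
    (hadmn : ∀ (ξ : OneDimAutRepH L) (v : HeightOneSpectrum (𝓞 ↥(maximalRealSubfield L))), (Pk' ξ v).πn.IsAdmissible)
    {t : OneDimAutRepH L → EvpData L H}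
    (ht : ∀ (ξ : OneDimAutRepH L), ∀ v ∉ ram ξ, t ξ v = (Pk' ξ v).πn.eigencharacter (cmLocalIntegralLevel L 3 H v) (νG' v))
    (ξ : OneDimAutRepH L) {S : Finset (HeightOneSpectrum (𝓞 ↥(maximalRealSubfield L)))} {Q : SpectralPacketG 𝔩 𝔞 μ}
    (hevp : EqOff L H S (Q.evpGψ ψ (fun w => (νG' w).map (ψ w))) (t ξ))
    {π : ∀ v : HeightOneSpectrum (𝓞 ↥(maximalRealSubfield L)), IrrClass ((cmDatum L 3 (splitForm L 3)).Local v)} (hπ : Q.fin.Mem π) :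
    ∀ᶠ v in cofinite, π v = (transportAPackets ψ Pk' ξ v).πn := by
  classical
  have hfin : ∀ᶠ v in cofinite, v ∉ S ∪ S₀ ∪ ram ξ := (S ∪ S₀ ∪ ram ξ).eventually_cofinite_notMem
  refine (hfin.and hπ.2).mono fun v hv => ?_
  obtain ⟨hvU, ⟨hunr, hsphv⟩⟩ := hv
  simp only [Finset.mem_union, not_or] at hvU
  obtain ⟨⟨hvS, hv₀⟩, hvr⟩ := hvU
  rw [hsphv, transportAPackets_πn]
  have heq : Q.fin.evpAtψ ψ (fun w => (νG' w).map (ψ w)) v = (Pk' ξ v).πn.eigencharacter (cmLocalIntegralLevel L 3 H v) (νG' v) := by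
    rw [← Q.evpGψ_eq_evpAtψ]
    exact (hevp v hvS).trans (ht ξ v hvr)
  exact Q.fin.sph_eq_comap_symm_of_evpAtψ_eq ψ νG' (h4 v) (hψK v hv₀) (hvol v) hunr (hKG3 v _ _ (h4 v _ hunr).1) (hadmn ξ v) (hsph ξ v hvr) heq

/-- **WITH THE RIGID CORE, A DISCRETE PACKET WITH THE ξ-GERM MEETS `Π(ξ_v)` AT EVERY PLACE**: its discretely occurring member family `π` (★ `exists_mem_occurs`) is `πⁿ(ξ_v) ∘ ψ_v⁻¹`
cofinitely (previous lemma), so the core — Thm. 13.3.6 (c), finite part: «`π` discrete, `π_v ≅ πⁿ(ξ_v)` a.e. ⇒ `π_v ∈ Π(ξ_v)` for all `v`» — puts `π_v ∈ {πⁿ(ξ_v)} ∪ πˢ(ξ_v)` everywhere, and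
`π_v ∈ Q_v`. [cite: Rogawski1990, §13.3 Thm. 13.3.6 (c) p. 202, p. 203 ¶2; §13.7 p. 206] [cite: CartierCorvallis1979, §IV.1 Cor. 4.1] -/
theorem meets_of_core_of_eqOff (h4 : ∀ v : HeightOneSpectrum (𝓞 ↥(maximalRealSubfield L)), (𝔩 v).UnramLaw)
    (hKG3 : ∀ (v : HeightOneSpectrum (𝓞 ↥(maximalRealSubfield L))) (P : (𝔩 v).Pkt), ∀ π ∈ (𝔩 v).mem P, π.IsAdmissible)
    (S₀ : Finset (HeightOneSpectrum (𝓞 ↥(maximalRealSubfield L))))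
    (hψK : ∀ v ∉ S₀, (cmLocalIntegralLevel L 3 H v).map (ψ v : (cmDatum L 3 H).Local v →* (cmDatum L 3 (splitForm L 3)).Local v) =
      cmLocalIntegralLevel L 3 (splitForm L 3) v)
    (hvol : ∀ v : HeightOneSpectrum (𝓞 ↥(maximalRealSubfield L)), (νG' v).real (cmLocalIntegralLevel L 3 H v : Set ((cmDatum L 3 H).Local v)) ≠ 0)
    (hsph : ∀ (ξ : OneDimAutRepH L), ∀ v ∉ ram ξ, (Pk' ξ v).πn.IsSpherical (cmLocalIntegralLevel L 3 H v))
    (hadmn : ∀ (ξ : OneDimAutRepH L) (v : HeightOneSpectrum (𝓞 ↥(maximalRealSubfield L))), (Pk' ξ v).πn.IsAdmissible)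
    {t : OneDimAutRepH L → EvpData L H}
    (ht : ∀ (ξ : OneDimAutRepH L), ∀ v ∉ ram ξ, t ξ v = (Pk' ξ v).πn.eigencharacter (cmLocalIntegralLevel L 3 H v) (νG' v))
    (hcore : ∀ (ξ : OneDimAutRepH L) (π : ∀ v : HeightOneSpectrum (𝓞 ↥(maximalRealSubfield L)), IrrClass ((cmDatum L 3 (splitForm L 3)).Local v)),
      F0P3GlobalPacketDiscrete.cmOccursInDiscreteSpectrum L 3 (splitForm L 3) μ π →
      (∀ᶠ v in cofinite, π v = (transportAPackets ψ Pk' ξ v).πn) →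
      ∀ v, π v = (transportAPackets ψ Pk' ξ v).πn ∨ (transportAPackets ψ Pk' ξ v).πs = some (π v))
    (ξ : OneDimAutRepH L) {S : Finset (HeightOneSpectrum (𝓞 ↥(maximalRealSubfield L)))} {Q : SpectralPacketG 𝔩 𝔞 μ}
    (hevp : EqOff L H S (Q.evpGψ ψ (fun w => (νG' w).map (ψ w))) (t ξ)) (v : HeightOneSpectrum (𝓞 ↥(maximalRealSubfield L))) :
    (transportAPackets ψ Pk' ξ v).πn ∈ (𝔩 v).mem (Q.fin.loc v) ∨ ∃ c, (transportAPackets ψ Pk' ξ v).πs = some c ∧ c ∈ (𝔩 v).mem (Q.fin.loc v) := by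
  obtain ⟨π, hπ, hocc⟩ := Q.exists_mem_occurs
  have hmem : π v ∈ (𝔩 v).mem (Q.fin.loc v) := hπ.1 v
  rcases hcore ξ π hocc (eventually_mem_eq_transport_πn_of_eqOff h4 hKG3 S₀ hψK hvol hsph hadmn ht ξ hevp hπ) v with h | h
  · exact Or.inl (h ▸ hmem)
  · exact Or.inr ⟨π v, h, hmem⟩

variable {infOf : GlobalPacket 𝔩 → 𝔞.PktInf} {aTok : ∀ v : HeightOneSpectrum (𝓞 ↥(maximalRealSubfield L)), Set (𝔩 v).Pkt}
  {PkInf : OneDimAutRepH L → LocalAPacket (GKIrrClass (uFormGroup (Fin 2) (Fin 1)))} {κ : OneDimAutRepH L → ℤ}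

/-- **ORGAN O3, KIT-GENERIC: (L1″) `XiRigidityGHom` FROM THE MARKER LAWS (KM1)∕(KJ-G)∕(KM2)∕(KM3), (KG1), (KG3′), THE GUARD, `vol(K′_v) ≠ 0`, THE RECORD SHAPES AND THE KIT-FREE RIGID CORE.**
All-L packets with the ξ-germ are absurd ((KM2) + Satake at one place, ★ p848041); all-A ones meet `Π(ξ_v)` everywhere (`meets_of_core_of_eqOff`), carry the signed ξ-shape token by token
((KM3), then (KM1)+(KJ-G) against `piXiHm h ξ`, ★ p847962) and are coherent, hence ARE `Π(ξ)`. [cite: Rogawski1990, §13.3 Thm. 13.3.5 p. 202, Thm. 13.3.6 (c) p. 202, p. 199 ¶2, p. 201 ll. 16–18; §13.2 p. 200 l. 1–3; §13.7 p. 206] [cite: CartierCorvallis1979, §IV.1 Cor. 4.1] -/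
theorem xiRigidityGHom_of_marker_laws_of_core
    {h : XiPacketsSignedHom 𝔩 𝔞 μ infOf aTok (transportAPackets ψ Pk') PkInf κ}
    (hKM1 : ∀ (v : HeightOneSpectrum (𝓞 ↥(maximalRealSubfield L))) (P P' : (𝔩 v).Pkt), (𝔩 v).mem P = (𝔩 v).mem P' → (∀ c, (𝔩 v).one P c = (𝔩 v).one P' c) →
      (P ∈ aTok v ↔ P' ∈ aTok v) → P = P')
    (hKJ : ∀ (v : HeightOneSpectrum (𝓞 ↥(maximalRealSubfield L))) (P : (𝔩 v).Pkt) (c : IrrClass ((UnitaryGroup.cmDatum L 3 (splitForm L 3)).Local v)),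
      c ∉ (𝔩 v).mem P → (𝔩 v).one P c = 0)
    (hKM2 : ∀ (ξ : OneDimAutRepH L) (v : HeightOneSpectrum (𝓞 ↥(maximalRealSubfield L))) (P : (𝔩 v).Pkt), P ∉ aTok v →
      (transportAPackets ψ Pk' ξ v).πn ∉ (𝔩 v).mem P)
    (hKM3 : ∀ (ξ : OneDimAutRepH L) (v : HeightOneSpectrum (𝓞 ↥(maximalRealSubfield L))) (P : (𝔩 v).Pkt), P ∈ aTok v →
      ((transportAPackets ψ Pk' ξ v).πn ∈ (𝔩 v).mem P ∨ ∃ c, (transportAPackets ψ Pk' ξ v).πs = some c ∧ c ∈ (𝔩 v).mem P) →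
      (∀ c, c ∈ (𝔩 v).mem P ↔ (c = (transportAPackets ψ Pk' ξ v).πn ∨ (transportAPackets ψ Pk' ξ v).πs = some c)) ∧
        (𝔩 v).one P (transportAPackets ψ Pk' ξ v).πn = 1 ∧ ∀ c ∈ (𝔩 v).mem P, c ≠ (transportAPackets ψ Pk' ξ v).πn → (𝔩 v).one P c = -1)
    (h4 : ∀ v : HeightOneSpectrum (𝓞 ↥(maximalRealSubfield L)), (𝔩 v).UnramLaw)
    (hKG3 : ∀ (v : HeightOneSpectrum (𝓞 ↥(maximalRealSubfield L))) (P : (𝔩 v).Pkt), ∀ π ∈ (𝔩 v).mem P, π.IsAdmissible)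
    (S₀ : Finset (HeightOneSpectrum (𝓞 ↥(maximalRealSubfield L))))
    (hψK : ∀ v ∉ S₀, (cmLocalIntegralLevel L 3 H v).map (ψ v : (cmDatum L 3 H).Local v →* (cmDatum L 3 (splitForm L 3)).Local v) =
      cmLocalIntegralLevel L 3 (splitForm L 3) v)
    (hvol : ∀ v : HeightOneSpectrum (𝓞 ↥(maximalRealSubfield L)), (νG' v).real (cmLocalIntegralLevel L 3 H v : Set ((cmDatum L 3 H).Local v)) ≠ 0)
    (hsph : ∀ (ξ : OneDimAutRepH L), ∀ v ∉ ram ξ, (Pk' ξ v).πn.IsSpherical (cmLocalIntegralLevel L 3 H v))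
    (hadmn : ∀ (ξ : OneDimAutRepH L) (v : HeightOneSpectrum (𝓞 ↥(maximalRealSubfield L))), (Pk' ξ v).πn.IsAdmissible)
    {tXi : OneDimAutRepH L → EvpData L H}
    (ht : ∀ (ξ : OneDimAutRepH L), ∀ v ∉ ram ξ, tXi ξ v = (Pk' ξ v).πn.eigencharacter (cmLocalIntegralLevel L 3 H v) (νG' v))
    (hcore : ∀ (ξ : OneDimAutRepH L) (π : ∀ v : HeightOneSpectrum (𝓞 ↥(maximalRealSubfield L)), IrrClass ((cmDatum L 3 (splitForm L 3)).Local v)),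
      F0P3GlobalPacketDiscrete.cmOccursInDiscreteSpectrum L 3 (splitForm L 3) μ π →
      (∀ᶠ v in cofinite, π v = (transportAPackets ψ Pk' ξ v).πn) →
      ∀ v, π v = (transportAPackets ψ Pk' ξ v).πn ∨ (transportAPackets ψ Pk' ξ v).πs = some (π v)) :
    XiRigidityGHom h ψ (fun w => (νG' w).map (ψ w)) tXi :=
  xiRigidityGHom_of_marker_laws_of_meet hKM1 hKJ hKM2 hKM3 h4 hKG3 S₀ hψK hvol hsph hadmn ht
    fun ξ _ Q _ _ hevp _ => meets_of_core_of_eqOff h4 hKG3 S₀ hψK hvol hsph hadmn ht hcore ξ (Q := Q) hevp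

end Summit.HodgeConjecture.HodgeConjecture.Cruxes.H413.F0P3SpectralPacket.SpectralPacketG

end
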